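/-
Copyright (c) 2026 the pub-hodgecm-mathlib formalisation cell (harness21).  Prover seat hodgecm-mathlib-LH1-p01 (g11): LH4 price-list item (P4) «DOCKINGS» (dealer
LH4-plan (g6) WORDs #40–#42), 2026-09-02.  Three seams of the WILD (dyadic) frame docked at their consumers.
-/
import Literature.NumberTheory.LocalFields.UnramifiedQuadraticUnitTrace          -- ★ p851638 `UnramifiedQuadraticNorm.exists_v_eq_one_v_add_map_eq_one` (unit of unit trace); brings the `Valued` residue plumbing of ★ `UnitaryLatticeTreeValencyInertPlace`
import Literature.NumberTheory.Automorphic.UnitaryGroupInertPlaceHyperbolicBasis   -- ★ `galAdicCompletionMap_galAdicCompletionMap_of_smul_eq` (`σ_w ∘ σ_w = id`), `exists_mul_galAdicCompletionMap_eq_of_isUnramifiedIn` (norm), `exists_glInt_placeForm_eq_formCongr_antidiagonal` (the `h2` consumer)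
import Literature.NumberTheory.Automorphic.RationalGoodVectorParityUniform       -- ★ p851636 `even_half_log_add_log(_add)_of_symmetric_frame` (consumer of `hM`); brings ★ kernel `SymmetricEigenframeParity.map_det_eq_neg_det_of_cols`
import Literature.NumberTheory.LocalFields.WildQuadraticEisensteinFrame          -- ★ p851611 (Π6) `even_log_of_map_eq_neg_of_skew_sq` (anti-fixed ⇒ even order in the unit-discriminant frame)
import HarnessLib

/-!
# Dockings of the wild seam: the unit-trace `b + σ_w b = 1` at every inert-unramified place, the even determinant of a symmetric
# eigenframe in the unit-discriminant frame, and the two-field transport of the symmetriser's seed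

Topic `NumberTheory/Automorphic`; namespace `Literature.NumberTheory.Automorphic.WildSeamDockings`.  THEOREMS ONLY (no definition, no
instance, no notation, no named fact, no `sorry`); kernel lane `--supports stmt-HodgeConjecture-24833`, count-neutral.  Cell `pub/hodgecm-mathlib`
(D-0151), crux H413 = `stmt-HodgeConjecture-24833`, half A line LH4 (M4 wall), price-list item (P4) of LH4-plan (g6) WORD #40: three SEAMS between
producers already in the tree (★ p851638, ★ p851611, ★ kernel `SymmetricEigenframeParity`) and their consumers (★ `HermitianUnimodularLocalRing`,
★ `UnitaryGroupInertPlaceHyperbolicBasis`, ★ `RationalGoodVectorParityUniform`), so that the consumers' dyadic binders (`h2 : 2 ∉ 𝔭_v`, `hM`, `hω∕hωtr∕hιω`)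
are discharged BY NAME at every residue characteristic.  This retires the `b = ½` ∕ `h2 : (2 : 𝓞 F) ∉ v.asIdeal` binder of ★
`UnitaryGroupInertPlaceHyperbolicBasis.exists_glInt_placeForm_eq_formCongr_antidiagonal` (its only use of `h2`) and the lines (d) + «Jacobowitz §7» of §4 of
B-p04 (g47)'s memo `MEMO-M4-wild-parity.v1` (4adf46b309de30b6).  (LH4-p01 (g6) typed an independent GREEN draft of (K1)–(K3), `F0/P3c/LH4/LH4-p01/g6/dock/`
4a95e0253b784b95, not filed; this file was written independently and adds (K1⁺).)  HONEST LABEL: HC_CM is proved only modulo the 7 printed citations (2 remaining named inputs: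
hLiu418 = stmt-HodgeConjecture-24832, h413 = stmt-HodgeConjecture-24833) until rung 0 closes; this file is count-neutral (pays no organ, opens no road).

THE MATHEMATICS.
* §1–§2 (K1) **the trace binder `htr : ∃ b, b + σ b = 1` at an inert-UNRAMIFIED place of a quadratic extension `E ∕ F` of number fields, ANY residue
  characteristic.**  ★ p851638 gives a unit `ω ∈ 𝒪_w` of unit trace `u := ω + σ_w ω ∈ 𝒪_w^×` (Serre, *Local Fields* V §2: the residue extension is separable,
  so its trace is onto); since `σ_w` is an involution, `σ_w u = u`, and `b := ω ∕ u` has `b + σ_w b = u ∕ u = 1`, `|b| = |ω| = 1`.  This is exactly the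
  hypothesis (trace) of Jacobowitz's orthonormal-basis theorem ★ `HermitianUnimodular.exists_formCongr_eq_one` [Jacobowitz1962 §7 Thm 7.1, unramified
  dyadic included], which ★ `exists_glInt_placeForm_eq_formCongr_antidiagonal` so far fed with `b = ½` under the NON-DYADIC binder `h2 : 2 ∉ 𝔭_v` — its
  only use of `h2`.  §2 therefore also carries the `h2`-FREE twin `exists_glInt_placeForm_eq_formCongr_antidiagonal_of_isUnramifiedIn`: a `w`-unimodular
  `c`-hermitian `J` has a hyperbolic `𝒪_w`-basis at EVERY inert-unramified place.
* §3 (K2) **the frame-parity binder `hM : Even (log|det M|)` in the unit-discriminant (wild) frame.**  For a symmetric eigenframe `M = [x₀ ∣ x₁ ∣ ι x₁]`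
  (`ι` fixes column `0` and exchanges columns `1, 2`) ★ `map_det_eq_neg_det_of_cols` gives `ι(det M) = −det M`; in the wild frame (`ι`-fixed elements have
  even order, a skew UNIT `α`, `α² = 1 + w`, `|w| < 1`, exists) anti-fixed elements have EVEN order (★ (Π6) `even_log_of_map_eq_neg_of_skew_sq`), so
  `log|det M|` is even — the token ★ `even_half_log_add_log_of_symmetric_frame` consumes; likewise `L = log|γ₁ − ιγ₁|` is even, which feeds the `+ L` form.
* §4 (K3) **the symmetriser's seed read in the eigen-field**: along `j : E →+* K` with `|j x| = |x|²`, `σ ∘ j = j ∘ σ_E`, `ι ∘ j = j`, a seed `ω ∈ E`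
  (`|ω| ≤ 1`, `|ω + σ_E ω| = 1`) maps to `j ω` with `|j ω| ≤ 1`, `|j ω + σ(j ω)| = 1`, `ι(j ω) = j ω` — the binders `hω`, `hωtr`, `hιω` of ★
  `exists_rational_good_of_even_uniform`.

## References
* [Jacobowitz1962] R. Jacobowitz, *Hermitian forms over local fields*, Amer. J. Math. 84 (1962) 441–465, §7 Thm. 7.1 (unramified case, dyadic included), §§9–11.
* [Serre1979] J.-P. Serre, *Local Fields*, GTM 67 (1979), Ch. V §2 Prop. 3 and Cor. (trace and norm in unramified extensions), Ch. I §6.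
* [Rogawski1990] J. D. Rogawski, *Automorphic Representations of Unitary Groups in Three Variables* (1990), §4.9 Lemma 4.9.3 p. 56.
-/

set_option autoImplicit false

noncomputable section

open scoped WithZero Matrix
open NumberField IsDedekindDomain
open Literature.NumberTheory.Automorphic Literature.NumberTheory.Automorphic.UnitaryGroup Literature.NumberTheory.Automorphic.UnitaryLatticeTree
open Literature.NumberTheory.QuadraticForms

/- TWO INTEGER RINGS.  The producers (★ p851638, ★ `UnitaryLatticeTreeValencyInertPlace`) speak Mathlib's `Valued` presentation (`Valued.integer`,
`Valued.ResidueField`, scoped notation `𝒪[K]`∕`𝓀[K]` of namespace `Valued`), the consumers (★ `UnitaryGroupInertPlaceHyperbolicBasis`, ★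
`UnitaryGroupSelfDualLocus`) the `ValuativeRel` presentation (`(ValuativeRel.valuation K).integer`, scoped notation `𝒪[K]` of namespace `ValuativeRel`);
the two subrings have the same members (★ `mem_integer_iff_mem_adicCompletionIntegers`).  §1 and §2a are field-level (no integer ring in the statements);
§2b opens ONLY the `ValuativeRel` notation and states the docked binders in the consumers' ring. -/

namespace Literature.NumberTheory.Automorphic.WildSeamDockings

/-! ## §1 Generic: a unit-trace element gives the (trace) binder `b + σ b = 1` for an involution `σ` (field level) -/

section Generic

variable {K : Type*} [Field K] {σ : K →+* K}

/-- **Docking device** (any subring `O` of `K` containing `b`, any endomorphism `σO` of `O` agreeing with `σ` on coercions): `∃ b' : O, b' + σO b' = 1` —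
the literal `htr` of ★ `HermitianUnimodular.exists_formCongr_eq_one` with `R := O`. [cite: Jacobowitz1962, §7 Thm. 7.1] -/
theorem exists_add_eq_one_of_coe_eq (O : Subring K) (σO : O →+* O) (hσO : ∀ x : O, ((σO x : O) : K) = σ x)
    {b : K} (hbO : b ∈ O) (hb : b + σ b = 1) : ∃ b' : O, b' + σO b' = 1 := by
  refine ⟨⟨b, hbO⟩, Subtype.ext ?_⟩
  change b + ((σO ⟨b, hbO⟩ : O) : K) = 1
  rw [hσO, hb]

variable [Valued K ℤᵐ⁰]

/-- **From a unit trace to the (trace) binder**: if `σ` is an involution and `ω + σ ω` is a unit (`|ω + σω| = 1`), then `b := ω ∕ (ω + σω)` has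
`b + σ b = 1` and `|b| = |ω|`. [cite: Jacobowitz1962, §7 Thm. 7.1] [cite: Serre1979, Ch. V §2] -/
theorem exists_v_eq_add_map_eq_one (hσσ : ∀ x, σ (σ x) = x) {ω : K} (hωtr : Valued.v (ω + σ ω) = 1) :
    ∃ b : K, Valued.v b = Valued.v ω ∧ b + σ b = 1 := by
  have hu0 : ω + σ ω ≠ 0 := fun h => by rw [h, map_zero] at hωtr; exact zero_ne_one hωtr
  refine ⟨ω / (ω + σ ω), by rw [map_div₀, hωtr, div_one], ?_⟩
  rw [map_div₀, map_add, hσσ, add_comm (σ ω) ω, ← add_div, div_self hu0]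

end Generic

/-! ## §2a (K1) The (trace) binder at an inert-UNRAMIFIED place of a quadratic extension of number fields, any residue characteristic — field level -/

section QuadraticField

open scoped Valued

variable {F E : Type} [Field F] [NumberField F] [Field E] [NumberField E] [Algebra F E] [Algebra.IsQuadraticExtension F E]
  (c : E ≃ₐ[F] E) {v : HeightOneSpectrum (𝓞 F)} (w : UnitaryGroup.PlacesOver E v)

/-- **(K1) `∃ b ∈ E_w`, `|b|_w = 1`, `b + σ_w b = 1` at an inert-unramified place** (`c ≠ 1`, `c • w = w`, `v` unramified in `E`; ANY residue
characteristic): `b := ω ∕ (ω + σ_w ω)` for ★ p851638's unit `ω` of unit trace (docked at `σ_w` through ★ `fintypeCard_valuedResidueField_eq_sq_of_inert`,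
★ `residueHom_galAdicCompletionMap_eq_pow_valued`), `σ_w ∘ σ_w = id` (★ `galAdicCompletionMap_galAdicCompletionMap_of_smul_eq`).  Replaces `b = ½` at dyadic `v`.
[cite: Serre1979, Ch. V §2] [cite: Jacobowitz1962, §7 Thm. 7.1] -/
theorem exists_v_eq_one_add_galAdicCompletionMap_eq_one (hc : c ≠ 1) (hw : c • w.1 = w.1) (hunr : Algebra.IsUnramifiedIn (𝓞 E) v.asIdeal) :
    ∃ b : w.1.adicCompletion E, Valued.v b = 1 ∧ b + galAdicCompletionMap (L := E) c hw b = 1 := by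
  haveI : Finite 𝓀[w.1.adicCompletion E] := finite_residueField_adicCompletion E w.1
  letI : Fintype 𝓀[w.1.adicCompletion E] := Fintype.ofFinite _
  have hvσ : ∀ x, Valued.v (galAdicCompletionMap (L := E) c hw x) = Valued.v x :=
    fun x => valued_galAdicCompletionMap (L := E) c hw x
  obtain ⟨σk, hσk⟩ := exists_residueField_ringHom_of_v_eq (K := w.1.adicCompletion E) hvσ
  obtain ⟨ω, hω, hωtr⟩ := LocalFields.UnramifiedQuadraticNorm.exists_v_eq_one_v_add_map_eq_one hvσ σk hσk
    (fintypeCard_valuedResidueField_eq_sq_of_inert c v hc hunr w hw)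
    (residueHom_galAdicCompletionMap_eq_pow_valued c v hc hunr w hw σk hσk)
  obtain ⟨b, hvb, hb⟩ :=
    exists_v_eq_add_map_eq_one (UnitaryGroup.galAdicCompletionMap_galAdicCompletionMap_of_smul_eq c w hc hw) hωtr
  exact ⟨b, hvb.trans hω, hb⟩

/-- (K1), integrality in Mathlib's `adicCompletionIntegers` currency: `∃ b ∈ 𝒪_w` (`w.1.adicCompletionIntegers E`), `b + σ_w b = 1`. [cite: Serre1979, Ch. V §2] -/
theorem exists_mem_adicCompletionIntegers_add_galAdicCompletionMap_eq_one (hc : c ≠ 1) (hw : c • w.1 = w.1)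
    (hunr : Algebra.IsUnramifiedIn (𝓞 E) v.asIdeal) :
    ∃ b : w.1.adicCompletion E, b ∈ w.1.adicCompletionIntegers E ∧ b + galAdicCompletionMap (L := E) c hw b = 1 := by
  obtain ⟨b, hvb, hb⟩ := exists_v_eq_one_add_galAdicCompletionMap_eq_one c w hc hw hunr
  exact ⟨b, by rw [HeightOneSpectrum.mem_adicCompletionIntegers, hvb], hb⟩

end QuadraticField

/-! ## §2b (K1) docked in the consumers' ring `𝒪[E_w]` (`ValuativeRel` presentation, as in ★ `UnitaryGroupInertPlaceHyperbolicBasis` ∕ ★ `UnitaryGroupSelfDualLocus`) -/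

section QuadraticInteger

open scoped ValuativeRel

variable {F E : Type} [Field F] [NumberField F] [Field E] [NumberField E] [Algebra F E] [Algebra.IsQuadraticExtension F E]
  (c : E ≃ₐ[F] E) {v : HeightOneSpectrum (𝓞 F)} (w : UnitaryGroup.PlacesOver E v)

/-- **(K1) in the shape of ★ `UnitaryGroupSelfDualLocus`'s `htr`**: `∃ b : 𝒪[E_w], (b : E_w) + σ_w b = 1` (`𝒪[E_w]` the `ValuativeRel` valuation ring;
membership via ★ `mem_integer_iff_mem_adicCompletionIntegers`). [cite: Jacobowitz1962, §7 Thm. 7.1] [cite: Serre1979, Ch. V §2] -/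
theorem exists_integer_coe_add_galAdicCompletionMap_eq_one (hc : c ≠ 1) (hw : c • w.1 = w.1) (hunr : Algebra.IsUnramifiedIn (𝓞 E) v.asIdeal) :
    ∃ b : 𝒪[w.1.adicCompletion E], (b : w.1.adicCompletion E) + galAdicCompletionMap (L := E) c hw b = 1 := by
  obtain ⟨b, hbO, hb⟩ := exists_mem_adicCompletionIntegers_add_galAdicCompletionMap_eq_one c w hc hw hunr
  exact ⟨⟨b, by rw [mem_integer_iff_mem_adicCompletionIntegers]; exact hbO⟩, hb⟩

/-- **(K1) in the shape of ★ `UnitaryGroupInertPlaceHyperbolicBasis`'s `htr`**: for the restriction `σO := σ_w.restrict 𝒪 𝒪 hmem` (any proof `hmem`),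
`∃ b : 𝒪[E_w], b + σO b = 1` — the literal (trace) hypothesis of ★ `HermitianUnimodular.exists_formCongr_eq_one` over `R := 𝒪[E_w]`, with NO `2 ∉ 𝔭_v`.
[cite: Jacobowitz1962, §7 Thm. 7.1] [cite: Serre1979, Ch. V §2] -/
theorem exists_add_restrict_galAdicCompletionMap_eq_one (hc : c ≠ 1) (hw : c • w.1 = w.1) (hunr : Algebra.IsUnramifiedIn (𝓞 E) v.asIdeal)
    (hmem : ∀ x ∈ 𝒪[w.1.adicCompletion E], galAdicCompletionMap (L := E) c hw x ∈ 𝒪[w.1.adicCompletion E]) :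
    ∃ b : 𝒪[w.1.adicCompletion E],
      b + (galAdicCompletionMap (L := E) c hw).restrict 𝒪[w.1.adicCompletion E] 𝒪[w.1.adicCompletion E] hmem b = 1 := by
  obtain ⟨b, hbO, hb⟩ := exists_mem_adicCompletionIntegers_add_galAdicCompletionMap_eq_one c w hc hw hunr
  exact exists_add_eq_one_of_coe_eq 𝒪[w.1.adicCompletion E] _ (fun _ => rfl)
    (by rw [mem_integer_iff_mem_adicCompletionIntegers]; exact hbO) hb

/-- **(K1⁺) A `σ_w`-HYPERBOLIC INTEGRAL BASIS FOR `J_w` AT EVERY INERT-UNRAMIFIED PLACE, DYADIC INCLUDED** — ★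
`exists_glInt_placeForm_eq_formCongr_antidiagonal` with its binder `(h2 : (2 : 𝓞 F) ∉ v.asIdeal)` removed (that binder served only `htr := ½`; here `htr` is
(K1)): at a place `v` of `F` UNRAMIFIED and NON-SPLIT in `E` (`c • w = w`), a `c`-hermitian `J ∈ M_N(E)` that is `w`-unimodular admits `T ∈ GL_N(𝒪_w)` with
`placeForm J w = (σ_w T)ᵀ · antidiag(1, …, 1) · T` [Jacobowitz1962, §7 Thm. 7.1: a unimodular hermitian lattice over the valuation ring of an unramified quadratic
extension has an orthonormal basis — unramified dyadic included].  Proof = the ★ proof verbatim with (trace) from (K1) and (norm) from ★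
`exists_mul_galAdicCompletionMap_eq_of_isUnramifiedIn`. [cite: Jacobowitz1962, §7 Thm. 7.1] [cite: Serre1979, Ch. V §2] -/
theorem exists_glInt_placeForm_eq_formCongr_antidiagonal_of_isUnramifiedIn (hc1 : c ≠ 1) (N : ℕ)
    (J : Matrix (Fin N) (Fin N) E) (hJh : (J.map c)ᵀ = J) (hw : c • w.1 = w.1)
    (hv : Algebra.IsUnramifiedIn (𝓞 E) v.asIdeal)
    (hJw : IsUnit (placeForm J w.1)) (hJi : hJw.unit ∈ glInt N (w.1.adicCompletion E)) :
    ∃ T : GL (Fin N) (w.1.adicCompletion E), T ∈ glInt N (w.1.adicCompletion E) ∧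
      placeForm J w.1 =
        formCongr (galAdicCompletionMap (L := E) c hw) T ((StdForm.antidiagonal N).over (w.1.adicCompletion E)) := by
  -- adapted from Literature/NumberTheory/Automorphic/UnitaryGroupInertPlaceHyperbolicBasis.lean :236–:306 (`h2` replaced by (K1))
  haveI : CharZero (w.1.adicCompletion E) := charZero_of_injective_algebraMap (algebraMap E _).injective
  -- the involution `σ_w` restricted to the valuation ring `𝒪 = 𝒪[E_w]`
  have hmem : ∀ x ∈ 𝒪[w.1.adicCompletion E], galAdicCompletionMap (L := E) c hw x ∈ 𝒪[w.1.adicCompletion E] :=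
    fun x hx => UnitaryGroup.galAdicCompletionMap_mem_integer c w hw hx
  let σO : 𝒪[w.1.adicCompletion E] →+* 𝒪[w.1.adicCompletion E] :=
    (galAdicCompletionMap (L := E) c hw).restrict 𝒪[w.1.adicCompletion E] 𝒪[w.1.adicCompletion E] hmem
  have hσO : ∀ x : 𝒪[w.1.adicCompletion E], ((σO x : 𝒪[w.1.adicCompletion E]) : w.1.adicCompletion E) =
      galAdicCompletionMap (L := E) c hw x := fun _ => rfl
  have hσσ : ∀ x, σO (σO x) = x := fun x =>
    Subtype.ext (UnitaryGroup.galAdicCompletionMap_galAdicCompletionMap_of_smul_eq c w hc1 hw x)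
  -- (trace): (K1), any residue characteristic
  have htr : ∃ b : 𝒪[w.1.adicCompletion E], b + σO b = 1 :=
    exists_add_restrict_galAdicCompletionMap_eq_one c w hc1 hw hv hmem
  -- (norm): `σ_w`-fixed units of `𝒪` are norms `t σ_w(t)`
  have hnorm : ∀ u : 𝒪[w.1.adicCompletion E], IsUnit u → σO u = u → ∃ t : 𝒪[w.1.adicCompletion E], t * σO t = u := by
    intro u hu hσu
    have hu1 : Valued.v (u : w.1.adicCompletion E) = 1 := by
      rw [← (ValuativeRel.isEquiv (ValuativeRel.valuation (w.1.adicCompletion E))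
        (Valued.v : Valuation (w.1.adicCompletion E) _)).eq_one_iff_eq_one]
      exact Valuation.Integers.one_of_isUnit (Valuation.integer.integers _) hu
    have hfix : galAdicCompletionMap (L := E) c hw u = u := by rw [← hσO, hσu]
    obtain ⟨t, ht1, htt⟩ := UnitaryGroup.exists_mul_galAdicCompletionMap_eq_of_isUnramifiedIn c w hc1 hw hv u hu1 hfix
    have htmem : t ∈ 𝒪[w.1.adicCompletion E] := by
      rw [mem_integer_iff_mem_adicCompletionIntegers, HeightOneSpectrum.mem_adicCompletionIntegers, ht1]
    exact ⟨⟨t, htmem⟩, Subtype.ext htt⟩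
  -- pull the two forms back to `GL_N(𝒪)`
  obtain ⟨H₀, hH₀⟩ := hJi
  have hH₀val : (H₀ : Matrix (Fin N) (Fin N) 𝒪[w.1.adicCompletion E]).map (𝒪[w.1.adicCompletion E]).subtype = placeForm J w.1 := by
    have h := congrArg (fun g : GL (Fin N) (w.1.adicCompletion E) => (g : Matrix (Fin N) (Fin N) (w.1.adicCompletion E))) hH₀
    rw [IsUnit.unit_spec] at h
    exact h
  have hinj : Function.Injective fun M : Matrix (Fin N) (Fin N) 𝒪[w.1.adicCompletion E] =>
      M.map (𝒪[w.1.adicCompletion E]).subtype := Matrix.map_injective Subtype.val_injective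
  have hcomm : (⇑(𝒪[w.1.adicCompletion E]).subtype ∘ ⇑σO) = ⇑(galAdicCompletionMap (L := E) c hw) ∘ ⇑(𝒪[w.1.adicCompletion E]).subtype :=
    funext fun x => hσO x
  have hH₀h : ((H₀ : Matrix (Fin N) (Fin N) 𝒪[w.1.adicCompletion E]).map σO)ᵀ = H₀ := by
    apply hinj
    change (((Units.val H₀).map σO)ᵀ).map _ = (Units.val H₀).map _
    rw [Matrix.transpose_map, Matrix.map_map, hcomm, ← Matrix.map_map, hH₀val]
    exact UnitaryGroup.placeForm_hermitian_of_smul_eq c w J hJh hw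
  have hH₀det : IsUnit (Units.val H₀).det := by
    rw [← Matrix.isUnit_iff_isUnit_det]
    exact Units.isUnit H₀
  have hJ₀h : (((StdForm.antidiagonal N).over 𝒪[w.1.adicCompletion E]).map σO)ᵀ = (StdForm.antidiagonal N).over 𝒪[w.1.adicCompletion E] := by
    rw [StdForm.over_map, StdForm.transpose_over]
  have hJ₀det : IsUnit ((StdForm.antidiagonal N).over 𝒪[w.1.adicCompletion E]).det :=
    (Matrix.isUnit_iff_isUnit_det _).1 (StdForm.isUnit_over _ _)
  -- Jacobowitz over the local ring `𝒪`
  obtain ⟨T₀, hT₀⟩ := HermitianUnimodular.exists_formCongr_eq σO hσσ htr hnorm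
    (H₀ : Matrix (Fin N) (Fin N) 𝒪[w.1.adicCompletion E]) ((StdForm.antidiagonal N).over 𝒪[w.1.adicCompletion E])
    hH₀h hH₀det hJ₀h hJ₀det
  refine ⟨Matrix.GeneralLinearGroup.map (𝒪[w.1.adicCompletion E]).subtype T₀, ⟨T₀, rfl⟩, ?_⟩
  -- push the congruence forward along `𝒪 ↪ E_w`
  have h := congrArg (fun M : Matrix (Fin N) (Fin N) 𝒪[w.1.adicCompletion E] => M.map (𝒪[w.1.adicCompletion E]).subtype) hT₀
  simp only [formCongr, Matrix.map_mul, Matrix.transpose_map, Matrix.map_map, hcomm, StdForm.over_map, hH₀val] at h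
  rw [← h]
  rfl

end QuadraticInteger

/-! ## §3 (K2) The even determinant of a symmetric eigenframe in the unit-discriminant frame -/

section Frame

variable {K : Type*} [Field K] [Valued K ℤᵐ⁰]

/-- **(K2) `log|det M|` IS EVEN for a symmetric eigenframe in the wild (unit-discriminant) frame**: `ι` fixes column `0` of `M` and exchanges
columns `1, 2` (so `ι(det M) = −det M`, ★ `map_det_eq_neg_det_of_cols`), the `ι`-fixed non-zero elements have even order (`hrE`, the consumer's binder
order) and a skew unit `α` (`ια = −α`, `α² = 1 + w`, `|w| < 1`) exists (so anti-fixed elements have even order, ★ (Π6)).  The `hM` of ★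
`even_half_log_add_log_of_symmetric_frame`. [cite: Rogawski1990, §4.9 Lemma 4.9.3 p. 56] [cite: Jacobowitz1962, §§9–11] [cite: Serre1979, Ch. I §6] -/
theorem even_log_v_det_of_cols_of_skew_sq (ι : K →+* K) (hrE : ∀ x : K, x ≠ 0 → ι x = x → Even (WithZero.log (Valued.v x)))
    {α w : K} (hια : ι α = -α) (hα : α * α = 1 + w) (hw : Valued.v w < 1)
    (M : Matrix (Fin 3) (Fin 3) K) (h0 : ∀ i, ι (M i 0) = M i 0) (h1 : ∀ i, ι (M i 1) = M i 2) (h2 : ∀ i, ι (M i 2) = M i 1)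
    (hM0 : M.det ≠ 0) : Even (WithZero.log (Valued.v M.det)) :=
  LocalFields.even_log_of_map_eq_neg_of_skew_sq ι (fun x hx hx0 => hrE x hx0 hx) hια hα hw hM0
    (SymmetricEigenframe.map_det_eq_neg_det_of_cols ι M h0 h1 h2)

/-- **(K2) `L = log|γ − ιγ|` IS EVEN** in the wild frame (`γ − ιγ` is `ι`-anti-fixed; non-zero when `ιγ ≠ γ`). [cite: Serre1979, Ch. I §6] [cite: Jacobowitz1962, §§9–11] -/
theorem even_log_v_sub_map_of_skew_sq (ι : K →+* K) (hιι : ∀ x, ι (ι x) = x)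
    (hrE : ∀ x : K, x ≠ 0 → ι x = x → Even (WithZero.log (Valued.v x)))
    {α w : K} (hια : ι α = -α) (hα : α * α = 1 + w) (hw : Valued.v w < 1) {γ : K} (hγ : ι γ ≠ γ) :
    Even (WithZero.log (Valued.v (γ - ι γ))) :=
  LocalFields.even_log_of_map_eq_neg_of_skew_sq ι (fun x hx hx0 => hrE x hx0 hx) hια hα hw (sub_ne_zero.2 (Ne.symm hγ))
    (by rw [map_sub, hιι, neg_sub])

/-- **(K2) docked: the frame parity pair `(hd0, hΦ)`** — `log|d₀|` even and `½·log|d₀| + log|d₁|` even — for a symmetric eigenframe `M` with unimodular Gram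
data in the wild frame (★ `even_half_log_add_log_of_symmetric_frame` ∘ `even_log_v_det_of_cols_of_skew_sq`). [cite: Rogawski1990, §4.9 Lemma 4.9.3 p. 56]
[cite: Jacobowitz1962, §7 Thm. 7.1; §§9–11] -/
theorem even_half_log_add_log_of_symmetric_frame_of_skew_sq (σ : K →+* K) (hσv : ∀ x, Valued.v (σ x) = Valued.v x)
    (ι : K →+* K) (hrE : ∀ x : K, x ≠ 0 → ι x = x → Even (WithZero.log (Valued.v x)))
    {α w : K} (hια : ι α = -α) (hα : α * α = 1 + w) (hw : Valued.v w < 1)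
    (H M : Matrix (Fin 3) (Fin 3) K) (d : Fin 3 → K) (hG : (M.map σ)ᵀ * H * M = Matrix.diagonal d)
    (hd0 : d 0 ≠ 0) (hd1 : d 1 ≠ 0) (hd12 : Valued.v (d 2) = Valued.v (d 1)) (hM0 : M.det ≠ 0) (hH : Valued.v H.det = 1)
    (h0 : ∀ i, ι (M i 0) = M i 0) (h1 : ∀ i, ι (M i 1) = M i 2) (h2 : ∀ i, ι (M i 2) = M i 1) :
    Even (WithZero.log (Valued.v (d 0))) ∧ Even (WithZero.log (Valued.v (d 0)) / 2 + WithZero.log (Valued.v (d 1))) :=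
  SymmetricEigenframe.even_half_log_add_log_of_symmetric_frame σ hσv H M d hG hd0 hd1 hd12 hM0 hH
    (even_log_v_det_of_cols_of_skew_sq ι hrE hια hα hw M h0 h1 h2 hM0)

/-- **(K2) docked, `+ L` form: the binders `(hd0, hΦL)` of ★ `exists_rational_good_of_even_uniform` token for token** in the wild frame, with
`L = log|γ − ιγ|` (the row's `h12`, `γ₂ = ιγ₁`) — both `log|det M|` and `L` are even (★ `even_half_log_add_log_add_of_symmetric_frame`).
[cite: Rogawski1990, §4.9 Lemma 4.9.3 p. 56] [cite: Jacobowitz1962, §7 Thm. 7.1; §§9–11] -/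
theorem even_half_log_add_log_add_of_symmetric_frame_of_skew_sq (σ : K →+* K) (hσv : ∀ x, Valued.v (σ x) = Valued.v x)
    (ι : K →+* K) (hιι : ∀ x, ι (ι x) = x) (hrE : ∀ x : K, x ≠ 0 → ι x = x → Even (WithZero.log (Valued.v x)))
    {α w : K} (hια : ι α = -α) (hα : α * α = 1 + w) (hw : Valued.v w < 1)
    (H M : Matrix (Fin 3) (Fin 3) K) (d : Fin 3 → K) (hG : (M.map σ)ᵀ * H * M = Matrix.diagonal d)
    (hd0 : d 0 ≠ 0) (hd1 : d 1 ≠ 0) (hd12 : Valued.v (d 2) = Valued.v (d 1)) (hM0 : M.det ≠ 0) (hH : Valued.v H.det = 1)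
    (h0 : ∀ i, ι (M i 0) = M i 0) (h1 : ∀ i, ι (M i 1) = M i 2) (h2 : ∀ i, ι (M i 2) = M i 1)
    {γ : K} (hγ : ι γ ≠ γ) {L : ℤ} (h12 : WithZero.log (Valued.v (γ - ι γ)) = L) :
    Even (WithZero.log (Valued.v (d 0))) ∧ Even (WithZero.log (Valued.v (d 0)) / 2 + WithZero.log (Valued.v (d 1)) + L) := by
  refine SymmetricEigenframe.even_half_log_add_log_add_of_symmetric_frame σ hσv H M d hG hd0 hd1 hd12 hM0 hH ?_
  rw [← h12]
  exact (even_log_v_det_of_cols_of_skew_sq ι hrE hια hα hw M h0 h1 h2 hM0).add (even_log_v_sub_map_of_skew_sq ι hιι hrE hια hα hw hγ)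

end Frame

/-! ## §4 (K3) The symmetriser's seed read in the eigen-field along `j : E →+* K` -/

section TwoField

variable {E K : Type*} [Field E] [Field K] [Valued E ℤᵐ⁰] [Valued K ℤᵐ⁰] (j : E →+* K) {σE : E →+* E} {σ ι : K →+* K}

/-- **(K3) the seed in the eigen-field**: along `j` with `|j x| = |x|²`, `σ ∘ j = j ∘ σ_E`, `ι ∘ j = j`, a seed `ω` of `E` (`|ω| ≤ 1`, `|ω + σ_E ω| = 1`) is read
as `j ω` with `|j ω| ≤ 1`, `|j ω + σ(j ω)| = 1`, `ι(j ω) = j ω` — the binders `hω`, `hωtr`, `hιω` of ★ `exists_rational_good_of_even_uniform`; at a CM place the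
seed is ★ p851638's. [cite: Serre1979, Ch. V §2; Ch. II §2] -/
theorem seed_map (hjv : ∀ x, Valued.v (j x) = Valued.v x ^ 2) (hσj : ∀ x, σ (j x) = j (σE x)) (hιj : ∀ x, ι (j x) = j x)
    {ω : E} (hω : Valued.v ω ≤ 1) (hωtr : Valued.v (ω + σE ω) = 1) :
    Valued.v (j ω) ≤ 1 ∧ Valued.v (j ω + σ (j ω)) = 1 ∧ ι (j ω) = j ω := by
  refine ⟨?_, ?_, hιj ω⟩
  · rw [hjv]
    exact pow_le_one₀ zero_le hω
  · rw [hσj, ← map_add, hjv, hωtr, one_pow]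

end TwoField

end Literature.NumberTheory.Automorphic.WildSeamDockings

end
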